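import Summits.AnomalousDissipation.AnomalousDissipation.Theorems.SolenoidalFractalHomogenisationLagrangianStepCellLawVOddGainDefectLowerEdge
import HarnessLib

/-!
# W5 odd half, branch B of D24-16 — §11: the slot response in AUTOCORRELATION FORM and the Laplace–cosine transform (K1L_D helper)

§11 of planner ad-ideate-p5 g8's crux workfile `Cruxes/LagrangianRenormalisationStep/OddGainDefectAutocorr.lean` v2 (crux write 8ce4ef592c1f,
sha c08ffae604bbe92b; K1L_D stmt-AnomalousDissipation-27980, stub `stub_cellLawV0_IS`, W5 odd half), landed byte-for-byte (first of three files;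
§12–§13 → `…CellLawVOddGainDefectSpectral`, §14–§15 → `…CellLawVOddGainDefectCosineMixture`).  Everything PROVED, no sorry, no named fact:
* `rampAutocorr ρ u = ∫₀¹ a(s)a(s − u)ds` (ramp autocorrelation); `qsKernel_eq_autocorr`, `form_qsResp_eq_autocorr(_Ioi)` —
  `xᵀf_T(B)z = T∫₀^∞ A(u)·xᵀe^{−uTB}z du` (Fubini on `(0,1]²`, the ramp kills `u ≥ s`); `qsRespScalar/Moment_eq_autocorr`;
* `integral_Ioi_cos_mul_form_exp` — the Laplace–cosine transform `∫₀^∞cos(ξu)·xᵀe^{−uC}z du = xᵀC(C² + ξ²)⁻¹z` for coercive `C` (FTC on `Ioi`),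
  with `isUnit_det_sq_add_of_coercive`, `abs_form_exp_le`, `hasDerivAt_const_dotProduct_exp`.
On top of the worker's `…CellLawVOddGainDefectLowerEdge` (p654671: `qsKernel` tools, `form_qsResp_eq`).
NOT a proof of the stub, of the crux, of Onsager's conjecture or of anomalous dissipation — rung-leaf F-D1.A0 analysis. Lander: prover ad-k3l-bookkeeping-p1 g5.
-/

set_option linter.dupNamespace false
set_option linter.style.longLine false

namespace Summit.AnomalousDissipation.AnomalousDissipation.Theorems.SolenoidalFractalHomogenisation.LagrangianStep.OddGain

open MeasureTheory Set Matrix Literature.Analysis Literature.Analysis.FluidPDE Literature.Analysis.FluidPDE.LatticeShear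
open Literature.Analysis.ODE.PeriodicAveraging

/-- The AUTOCORRELATION of the unit ramp profile at lag `u`: `A(u) = ∫₀¹ a(s) a(s − u) ds`. [folklore] -/
noncomputable def rampAutocorr (ρ u : ℝ) : ℝ :=
  ∫ s in (0:ℝ)..1, LatticeShear.LatticeWord.trapezoid 0 1 ρ s * LatticeShear.LatticeWord.trapezoid 0 1 ρ (s - u)

/-- The unit ramp profile vanishes at non-positive arguments (`ρ > 0`). [folklore] -/
theorem trapezoid_unit_eq_zero_of_nonpos {ρ : ℝ} (hρ : 0 < ρ) {y : ℝ} (hy : y ≤ 0) :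
    LatticeShear.LatticeWord.trapezoid 0 1 ρ y = 0 := by
  unfold LatticeShear.LatticeWord.trapezoid
  have h1 : (y - 0) / (ρ * 1) ≤ 0 := by
    rw [sub_zero, mul_one]; exact div_nonpos_of_nonpos_of_nonneg hy hρ.le
  have h2 : min 1 (min ((y - 0) / (ρ * 1)) ((0 + 1 - y) / (ρ * 1))) ≤ 0 :=
    (min_le_right _ _).trans ((min_le_left _ _).trans h1)
  exact max_eq_left h2

/-- The unit ramp profile vanishes at arguments `≥ 1` (`ρ > 0`). [folklore] -/
theorem trapezoid_unit_eq_zero_of_one_le {ρ : ℝ} (hρ : 0 < ρ) {y : ℝ} (hy : 1 ≤ y) :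
    LatticeShear.LatticeWord.trapezoid 0 1 ρ y = 0 := by
  unfold LatticeShear.LatticeWord.trapezoid
  have h1 : (0 + 1 - y) / (ρ * 1) ≤ 0 := by
    rw [zero_add, mul_one]; exact div_nonpos_of_nonpos_of_nonneg (by linarith) hρ.le
  have h2 : min 1 (min ((y - 0) / (ρ * 1)) ((0 + 1 - y) / (ρ * 1))) ≤ 0 :=
    (min_le_right _ _).trans ((min_le_right _ _).trans h1)
  exact max_eq_left h2

/-- The autocorrelation vanishes at lags `u ≥ 1`. [folklore] -/
theorem rampAutocorr_eq_zero_of_one_le {ρ : ℝ} (hρ : 0 < ρ) {u : ℝ} (hu : 1 ≤ u) : rampAutocorr ρ u = 0 := by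
  unfold rampAutocorr
  have h : ∫ s in (0:ℝ)..1, LatticeShear.LatticeWord.trapezoid 0 1 ρ s * LatticeShear.LatticeWord.trapezoid 0 1 ρ (s - u) =
      ∫ s in (0:ℝ)..1, (0:ℝ) := by
    refine intervalIntegral.integral_congr fun s hs => ?_
    rw [uIcc_of_le zero_le_one] at hs
    show LatticeShear.LatticeWord.trapezoid 0 1 ρ s * LatticeShear.LatticeWord.trapezoid 0 1 ρ (s - u) = 0
    rw [trapezoid_unit_eq_zero_of_nonpos hρ (y := s - u) (by linarith [hs.2]), mul_zero]
  rw [h, intervalIntegral.integral_zero]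

/-- Inner substitution `x = s − u`: `∫₀ˢ a(x) k(T(s−x)) dx = ∫₀ˢ a(s−u) k(Tu) du`. [folklore] -/
theorem qsKernel_inner_comp_sub (ρ T : ℝ) (k : ℝ → ℝ) (s : ℝ) :
    ∫ x in (0:ℝ)..s, LatticeShear.LatticeWord.trapezoid 0 1 ρ x * k (T * (s - x)) =
      ∫ u in (0:ℝ)..s, LatticeShear.LatticeWord.trapezoid 0 1 ρ (s - u) * k (T * u) := by
  have h := intervalIntegral.integral_comp_sub_left
    (fun u => LatticeShear.LatticeWord.trapezoid 0 1 ρ (s - u) * k (T * u)) (a := (0:ℝ)) (b := s) s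
  simp only [sub_sub_cancel, sub_self, sub_zero] at h
  exact h

/-- Extension of the inner integral to `[0, 1]` (the profile kills `u ≥ s`): for `0 ≤ s ≤ 1`,
`∫₀ˢ a(s−u) k(Tu) du = ∫₀¹ a(s−u) k(Tu) du`. [folklore] -/
theorem qsKernel_inner_extend {ρ : ℝ} (hρ : 0 < ρ) (T : ℝ) {k : ℝ → ℝ} (hk : Continuous k) {s : ℝ}
    (hs : s ∈ Icc (0:ℝ) 1) :
    ∫ u in (0:ℝ)..s, LatticeShear.LatticeWord.trapezoid 0 1 ρ (s - u) * k (T * u) =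
      ∫ u in (0:ℝ)..1, LatticeShear.LatticeWord.trapezoid 0 1 ρ (s - u) * k (T * u) := by
  have hcont : Continuous fun u => LatticeShear.LatticeWord.trapezoid 0 1 ρ (s - u) * k (T * u) :=
    ((continuous_trapezoid_unit ρ).comp (continuous_const.sub continuous_id)).mul
      (hk.comp (continuous_const.mul continuous_id))
  have hzero : ∫ u in s..1, LatticeShear.LatticeWord.trapezoid 0 1 ρ (s - u) * k (T * u) = 0 := by
    have h : ∫ u in s..1, LatticeShear.LatticeWord.trapezoid 0 1 ρ (s - u) * k (T * u) = ∫ u in s..1, (0:ℝ) := by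
      refine intervalIntegral.integral_congr fun u hu => ?_
      rw [uIcc_of_le hs.2] at hu
      show LatticeShear.LatticeWord.trapezoid 0 1 ρ (s - u) * k (T * u) = 0
      rw [trapezoid_unit_eq_zero_of_nonpos hρ (by linarith [hu.1]), zero_mul]
    rw [h, intervalIntegral.integral_zero]
  rw [← intervalIntegral.integral_add_adjacent_intervals (hcont.intervalIntegrable 0 s) (hcont.intervalIntegrable s 1),
    hzero, add_zero]

/-- **The slot functional through the autocorrelation** (`ρ > 0`, continuous `k`):
`T ∫₀¹ a(s) ∫₀ˢ a(x) k(T(s−x)) dx ds = T ∫₀¹ A(u) k(Tu) du`. [folklore] -/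
theorem qsKernel_eq_autocorr {ρ : ℝ} (hρ : 0 < ρ) (T : ℝ) {k : ℝ → ℝ} (hk : Continuous k) :
    T * ∫ s in (0:ℝ)..1, LatticeShear.LatticeWord.trapezoid 0 1 ρ s *
        ∫ x in (0:ℝ)..s, LatticeShear.LatticeWord.trapezoid 0 1 ρ x * k (T * (s - x)) =
    T * ∫ u in (0:ℝ)..1, rampAutocorr ρ u * k (T * u) := by
  congr 1
  -- the integrand on the square
  set F : ℝ → ℝ → ℝ := fun s u =>
    LatticeShear.LatticeWord.trapezoid 0 1 ρ s * (LatticeShear.LatticeWord.trapezoid 0 1 ρ (s - u) * k (T * u)) with hF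
  have hFc : Continuous (Function.uncurry F) := by
    refine ((continuous_trapezoid_unit ρ).comp continuous_fst).mul
      (((continuous_trapezoid_unit ρ).comp (continuous_fst.sub continuous_snd)).mul (hk.comp ?_))
    exact continuous_const.mul continuous_snd
  -- Step 1: rewrite the inner integral (substitution + extension), pull `a(s)` inside
  have h1 : ∫ s in (0:ℝ)..1, LatticeShear.LatticeWord.trapezoid 0 1 ρ s *
        ∫ x in (0:ℝ)..s, LatticeShear.LatticeWord.trapezoid 0 1 ρ x * k (T * (s - x)) =
      ∫ s in (0:ℝ)..1, ∫ u in (0:ℝ)..1, F s u := by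
    refine intervalIntegral.integral_congr fun s hs => ?_
    rw [uIcc_of_le zero_le_one] at hs
    simp only [hF]
    rw [qsKernel_inner_comp_sub, qsKernel_inner_extend hρ T hk hs, ← intervalIntegral.integral_const_mul]
  -- Step 2: Fubini on the square `(0,1] × (0,1]`
  have hint : Integrable (Function.uncurry F) ((volume.restrict (Ioc (0:ℝ) 1)).prod (volume.restrict (Ioc (0:ℝ) 1))) := by
    have hI : IntegrableOn (Function.uncurry F) (Icc (0:ℝ) 1 ×ˢ Icc (0:ℝ) 1) (volume : Measure (ℝ × ℝ)) :=
      hFc.continuousOn.integrableOn_compact (isCompact_Icc.prod isCompact_Icc)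
    have hI' := hI.mono_set (prod_mono (Ioc_subset_Icc_self) (Ioc_subset_Icc_self) :
      Ioc (0:ℝ) 1 ×ˢ Ioc (0:ℝ) 1 ⊆ Icc (0:ℝ) 1 ×ˢ Icc (0:ℝ) 1)
    rw [IntegrableOn, Measure.volume_eq_prod, ← Measure.prod_restrict] at hI'
    exact hI'
  have h2 : ∫ s in (0:ℝ)..1, ∫ u in (0:ℝ)..1, F s u = ∫ u in (0:ℝ)..1, ∫ s in (0:ℝ)..1, F s u := by
    simp only [intervalIntegral.integral_of_le zero_le_one]
    exact integral_integral_swap hint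
  -- Step 3: factor `k(Tu)` out of the inner `s`-integral
  have h3 : ∫ u in (0:ℝ)..1, ∫ s in (0:ℝ)..1, F s u = ∫ u in (0:ℝ)..1, rampAutocorr ρ u * k (T * u) := by
    refine intervalIntegral.integral_congr fun u _ => ?_
    simp only [hF, rampAutocorr]
    rw [← intervalIntegral.integral_mul_const]
    exact intervalIntegral.integral_congr fun s _ => (mul_assoc _ _ _).symm
  rw [h1, h2, h3]

/-- The autocorrelation is continuous in the lag. [folklore] -/
theorem continuous_rampAutocorr (ρ : ℝ) : Continuous (rampAutocorr ρ) := by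
  have h : Continuous (Function.uncurry fun u s : ℝ =>
      LatticeShear.LatticeWord.trapezoid 0 1 ρ s * LatticeShear.LatticeWord.trapezoid 0 1 ρ (s - u)) :=
    ((continuous_trapezoid_unit ρ).comp continuous_snd).mul
      ((continuous_trapezoid_unit ρ).comp (continuous_snd.sub continuous_fst))
  exact intervalIntegral.continuous_parametric_intervalIntegral_of_continuous (a₀ := 0) h continuous_const

/-- The autocorrelation is non-negative (`ρ`-ramps are non-negative). [folklore] -/
theorem rampAutocorr_nonneg (ρ u : ℝ) : 0 ≤ rampAutocorr ρ u :=
  intervalIntegral.integral_nonneg zero_le_one fun s _ =>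
    mul_nonneg (trapezoid_unit_nonneg ρ s) (trapezoid_unit_nonneg ρ (s - u))

/-- **The bilinear form of `qsResp` through the autocorrelation**:
`vᵀ f_T(B) w = T ∫₀¹ A(u) · vᵀ e^{−(Tu)B} w du`. [folklore] -/
theorem form_qsResp_eq_autocorr {ρ : ℝ} (hρ : 0 < ρ) (T : ℝ) (B : Matrix (Fin 3) (Fin 3) ℝ) (v w : Fin 3 → ℝ) :
    v ⬝ᵥ (qsResp ρ T B) *ᵥ w =
      T * ∫ u in (0:ℝ)..1, rampAutocorr ρ u * (v ⬝ᵥ (NormedSpace.exp (-((T * u) • B))) *ᵥ w) := by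
  rw [form_qsResp_eq]
  exact qsKernel_eq_autocorr hρ T (k := fun t => v ⬝ᵥ (NormedSpace.exp (-(t • B))) *ᵥ w)
    (continuous_const.dotProduct (continuous_exp_neg_smul_mulVec B w))

/-- The scalar slot response through the autocorrelation: `f_T(a) = T ∫₀¹ A(u) e^{−Tua} du`. [folklore] -/
theorem qsRespScalar_eq_autocorr {ρ : ℝ} (hρ : 0 < ρ) (T a : ℝ) :
    qsRespScalar ρ T a = T * ∫ u in (0:ℝ)..1, rampAutocorr ρ u * Real.exp (-(T * u) * a) := by
  unfold qsRespScalar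
  exact qsKernel_eq_autocorr hρ T (k := fun t => Real.exp (-t * a)) (by fun_prop)

/-- The first kernel moment through the autocorrelation: `g_T(a) = T ∫₀¹ A(u) (Tu) e^{−Tua} du`. [folklore] -/
theorem qsRespMoment_eq_autocorr {ρ : ℝ} (hρ : 0 < ρ) (T a : ℝ) :
    qsRespMoment ρ T a = T * ∫ u in (0:ℝ)..1, rampAutocorr ρ u * ((T * u) * Real.exp (-(T * u) * a)) := by
  unfold qsRespMoment
  exact qsKernel_eq_autocorr hρ T (k := fun t => t * Real.exp (-t * a)) (by fun_prop)

/-- Extension of the lag integral to the half-line (the autocorrelation kills `u ≥ 1`):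
`∫_{(0,∞)} A(u) k(Tu) du = ∫₀¹ A(u) k(Tu) du`. [folklore] -/
theorem autocorr_setIntegral_Ioi_eq {ρ : ℝ} (hρ : 0 < ρ) (T : ℝ) {k : ℝ → ℝ} (hk : Continuous k) :
    ∫ u in Ioi (0:ℝ), rampAutocorr ρ u * k (T * u) = ∫ u in (0:ℝ)..1, rampAutocorr ρ u * k (T * u) := by
  have hc : Continuous fun u => rampAutocorr ρ u * k (T * u) :=
    (continuous_rampAutocorr ρ).mul (hk.comp (continuous_const.mul continuous_id))
  have hzero : EqOn (fun u => rampAutocorr ρ u * k (T * u)) (fun _ => (0:ℝ)) (Ioi (1:ℝ)) := fun u hu => by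
    show rampAutocorr ρ u * k (T * u) = 0
    rw [rampAutocorr_eq_zero_of_one_le hρ (le_of_lt hu), zero_mul]
  have hI1 : IntegrableOn (fun u => rampAutocorr ρ u * k (T * u)) (Ioc (0:ℝ) 1) volume :=
    (hc.continuousOn.integrableOn_compact isCompact_Icc).mono_set Ioc_subset_Icc_self
  have hI2 : IntegrableOn (fun u => rampAutocorr ρ u * k (T * u)) (Ioi (1:ℝ)) volume :=
    integrableOn_zero.congr_fun hzero.symm measurableSet_Ioi
  rw [← Ioc_union_Ioi_eq_Ioi zero_le_one, setIntegral_union (Ioc_disjoint_Ioi_same) measurableSet_Ioi hI1 hI2,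
    setIntegral_congr_fun measurableSet_Ioi hzero, integral_zero, add_zero,
    intervalIntegral.integral_of_le zero_le_one]

/-- **Half-line autocorrelation form of the slot response in the scaled block `T·B`** (the starting point of `CosineMixture`):
`xᵀ f_T(B) z = T ∫_{(0,∞)} A(u) · xᵀ e^{−u(TB)} z du`. [folklore] -/
theorem form_qsResp_eq_autocorr_Ioi {ρ : ℝ} (hρ : 0 < ρ) (T : ℝ) (B : Matrix (Fin 3) (Fin 3) ℝ) (v w : Fin 3 → ℝ) :
    v ⬝ᵥ (qsResp ρ T B) *ᵥ w =
      T * ∫ u in Ioi (0:ℝ), rampAutocorr ρ u * (v ⬝ᵥ (NormedSpace.exp (-(u • (T • B)))) *ᵥ w) := by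
  have hk : Continuous fun t : ℝ => v ⬝ᵥ (NormedSpace.exp (-(t • B))) *ᵥ w :=
    continuous_const.dotProduct (continuous_exp_neg_smul_mulVec B w)
  have h := autocorr_setIntegral_Ioi_eq hρ T hk
  have e : ∀ u : ℝ, u • (T • B) = (T * u) • B := fun u => by rw [smul_smul, mul_comm]
  simp_rw [e]
  rw [form_qsResp_eq_autocorr hρ, ← h]

/-! ## The Laplace–cosine transform of the semigroup form is the RESOLVENT ATOM (second brick of `CosineMixture`) -/

section LaplaceCosine

/-- `0 ≤ v·v`. [folklore] -/
private theorem dps_nonneg (v : Fin 3 → ℝ) : 0 ≤ v ⬝ᵥ v := by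
  unfold dotProduct; exact Finset.sum_nonneg fun i _ => mul_self_nonneg _

/-- Derivative of the semigroup form `u ↦ xᵀ e^{−uC} w`: `−xᵀ C e^{−uC} w`. [folklore] -/
theorem hasDerivAt_const_dotProduct_exp (C : Matrix (Fin 3) (Fin 3) ℝ) (x w : Fin 3 → ℝ) (u : ℝ) :
    HasDerivAt (fun u : ℝ => x ⬝ᵥ (NormedSpace.exp (-(u • C))) *ᵥ w)
      (-(x ⬝ᵥ C *ᵥ ((NormedSpace.exp (-(u • C))) *ᵥ w))) u := by
  have hg := hasDerivAt_exp_neg_smul_mulVec C w u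
  rw [hasDerivAt_pi] at hg
  have h := HasDerivAt.fun_sum (u := Finset.univ) fun i _ => (hg i).const_mul (x i)
  show HasDerivAt (fun u : ℝ => ∑ i, x i * ((NormedSpace.exp (-(u • C))) *ᵥ w) i) _ u
  refine h.congr_deriv ?_
  simp only [dotProduct, Pi.neg_apply, mul_neg, Finset.sum_neg_distrib]

/-- `C` commutes with its semigroup: `C e^{−uC} w = e^{−uC} C w`. [folklore] -/
theorem mulVec_exp_neg_smul_comm (C : Matrix (Fin 3) (Fin 3) ℝ) (w : Fin 3 → ℝ) (u : ℝ) :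
    C *ᵥ ((NormedSpace.exp (-(u • C))) *ᵥ w) = (NormedSpace.exp (-(u • C))) *ᵥ (C *ᵥ w) := by
  rw [Matrix.mulVec_mulVec, Matrix.mulVec_mulVec, (((Commute.refl C).smul_right u).neg_right).exp_right.eq]

/-- `C² + s` has unit determinant for `s ≥ 0` when `C` is coercive (`lo|x|² ≤ xᵀCx`, `lo > 0`). [folklore] -/
theorem isUnit_det_sq_add_of_coercive {C : Matrix (Fin 3) (Fin 3) ℝ} {lo s : ℝ} (hlo : 0 < lo) (hs : 0 ≤ s)
    (hco : ∀ x : Fin 3 → ℝ, lo * (x ⬝ᵥ x) ≤ x ⬝ᵥ C *ᵥ x) :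
    IsUnit (C * C + s • (1 : Matrix (Fin 3) (Fin 3) ℝ)).det := by
  rw [← Matrix.isUnit_iff_isUnit_det, ← Matrix.mulVec_injective_iff_isUnit]
  have hker : ∀ w : Fin 3 → ℝ, (C * C + s • (1 : Matrix (Fin 3) (Fin 3) ℝ)) *ᵥ w = 0 → w = 0 := by
    intro w hw
    have hw' : C *ᵥ (C *ᵥ w) = -(s • w) := by
      rw [Matrix.add_mulVec, Matrix.smul_mulVec, Matrix.one_mulVec, ← Matrix.mulVec_mulVec] at hw
      exact eq_neg_of_add_eq_zero_left hw
    set u := C *ᵥ w with hu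
    have h1 : u ⬝ᵥ C *ᵥ u = -(s * (w ⬝ᵥ C *ᵥ w)) := by
      rw [hw', dotProduct_neg, dotProduct_smul, smul_eq_mul, hu, dotProduct_comm (C *ᵥ w) w]
    have hwpos : 0 ≤ w ⬝ᵥ C *ᵥ w := le_trans (mul_nonneg hlo.le (dps_nonneg _)) (hco w)
    have hu0 : u ⬝ᵥ u ≤ 0 := by
      have := hco u
      have : lo * (u ⬝ᵥ u) ≤ 0 := by rw [h1] at this; nlinarith
      have huu : 0 ≤ u ⬝ᵥ u := dps_nonneg u
      nlinarith
    have huz : u = 0 := dotProduct_self_eq_zero.1 (le_antisymm hu0 (dps_nonneg _))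
    have hw0 : w ⬝ᵥ C *ᵥ w = 0 := by rw [← hu, huz, dotProduct_zero]
    have hww : lo * (w ⬝ᵥ w) ≤ 0 := by rw [← hw0]; exact hco w
    have hww' : w ⬝ᵥ w ≤ 0 := by
      have h0 : 0 ≤ w ⬝ᵥ w := dps_nonneg w
      nlinarith
    exact dotProduct_self_eq_zero.1 (le_antisymm hww' (dps_nonneg _))
  intro w₁ w₂ h
  have : (C * C + s • (1 : Matrix (Fin 3) (Fin 3) ℝ)) *ᵥ (w₁ - w₂) = 0 := by
    rw [Matrix.mulVec_sub, h, sub_self]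
  exact sub_eq_zero.1 (hker _ this)

/-- Bound on the semigroup form of a coercive block: `|xᵀe^{−uC}w| ≤ e^{−lo u}√(x·x)√(w·w)` (`u ≥ 0`). [folklore] -/
theorem abs_form_exp_le {C : Matrix (Fin 3) (Fin 3) ℝ} {lo : ℝ}
    (hco : ∀ x : Fin 3 → ℝ, lo * (x ⬝ᵥ x) ≤ x ⬝ᵥ C *ᵥ x) (x w : Fin 3 → ℝ) {u : ℝ} (hu : 0 ≤ u) :
    |x ⬝ᵥ (NormedSpace.exp (-(u • C))) *ᵥ w| ≤ Real.exp (-(lo * u)) * (Real.sqrt (x ⬝ᵥ x) * Real.sqrt (w ⬝ᵥ w)) := by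
  have hcs := abs_dotProduct_le_sqrt_mul_sqrt x ((NormedSpace.exp (-(u • C))) *ᵥ w)
  have hdec := sqrt_dotProduct_exp_le hco w hu
  calc |x ⬝ᵥ (NormedSpace.exp (-(u • C))) *ᵥ w|
      ≤ Real.sqrt (x ⬝ᵥ x) * Real.sqrt (((NormedSpace.exp (-(u • C))) *ᵥ w) ⬝ᵥ ((NormedSpace.exp (-(u • C))) *ᵥ w)) := hcs
    _ ≤ Real.sqrt (x ⬝ᵥ x) * (Real.exp (-(lo * u)) * Real.sqrt (w ⬝ᵥ w)) :=
        mul_le_mul_of_nonneg_left hdec (Real.sqrt_nonneg _)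
    _ = Real.exp (-(lo * u)) * (Real.sqrt (x ⬝ᵥ x) * Real.sqrt (w ⬝ᵥ w)) := by ring

/-- **LAPLACE–COSINE TRANSFORM = RESOLVENT ATOM.**  For a coercive block `C` (`lo|x|² ≤ xᵀCx`, `lo > 0`) and every `ξ`:
`u ↦ cos(ξu)·xᵀe^{−uC}z` is integrable on `(0, ∞)` and `∫₀^∞ cos(ξu)·xᵀe^{−uC}z du = xᵀ C(C² + ξ²)⁻¹ z`. [folklore] -/
theorem integral_Ioi_cos_mul_form_exp {C : Matrix (Fin 3) (Fin 3) ℝ} {lo : ℝ} (hlo : 0 < lo)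
    (hco : ∀ x : Fin 3 → ℝ, lo * (x ⬝ᵥ x) ≤ x ⬝ᵥ C *ᵥ x) (ξ : ℝ) (x z : Fin 3 → ℝ) :
    IntegrableOn (fun u : ℝ => Real.cos (ξ * u) * (x ⬝ᵥ (NormedSpace.exp (-(u • C))) *ᵥ z)) (Ioi 0) ∧
    ∫ u in Ioi (0:ℝ), Real.cos (ξ * u) * (x ⬝ᵥ (NormedSpace.exp (-(u • C))) *ᵥ z) =
      x ⬝ᵥ (C * (C * C + ξ ^ 2 • (1 : Matrix (Fin 3) (Fin 3) ℝ))⁻¹) *ᵥ z := by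
  set S : Matrix (Fin 3) (Fin 3) ℝ := C * C + ξ ^ 2 • (1 : Matrix (Fin 3) (Fin 3) ℝ) with hS
  have hunit : IsUnit S.det := isUnit_det_sq_add_of_coercive hlo (sq_nonneg ξ) hco
  -- the two orbits: `z' = S⁻¹ z`, `z'' = C z'`
  set z' : Fin 3 → ℝ := S⁻¹ *ᵥ z with hz'
  set z'' : Fin 3 → ℝ := C *ᵥ z' with hz''
  have hSz : C *ᵥ z'' + ξ ^ 2 • z' = z := by
    calc C *ᵥ z'' + ξ ^ 2 • z' = (C * C + ξ ^ 2 • (1 : Matrix (Fin 3) (Fin 3) ℝ)) *ᵥ z' := by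
          rw [Matrix.add_mulVec, Matrix.smul_mulVec, Matrix.one_mulVec, hz'', Matrix.mulVec_mulVec]
      _ = z := by rw [← hS, hz', Matrix.mulVec_mulVec, Matrix.mul_nonsing_inv _ hunit, Matrix.one_mulVec]
  -- the primitive `φ(u) = −cos(ξu)·xᵀe^{−uC}z'' + ξ sin(ξu)·xᵀe^{−uC}z'`
  set a : ℝ → ℝ := fun u => x ⬝ᵥ (NormedSpace.exp (-(u • C))) *ᵥ z'' with ha
  set b : ℝ → ℝ := fun u => x ⬝ᵥ (NormedSpace.exp (-(u • C))) *ᵥ z' with hb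
  set φ : ℝ → ℝ := fun u => -Real.cos (ξ * u) * a u + ξ * Real.sin (ξ * u) * b u with hφ
  set f : ℝ → ℝ := fun u => Real.cos (ξ * u) * (x ⬝ᵥ (NormedSpace.exp (-(u • C))) *ᵥ z) with hf
  -- derivative of the primitive
  have hderiv : ∀ u : ℝ, HasDerivAt φ (f u) u := by
    intro u
    have hA := hasDerivAt_const_dotProduct_exp C x z'' u
    have hB := hasDerivAt_const_dotProduct_exp C x z' u
    have hcos : HasDerivAt (fun u : ℝ => Real.cos (ξ * u)) (-Real.sin (ξ * u) * (ξ * 1)) u :=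
      ((hasDerivAt_id' u).const_mul ξ).cos
    have hsin : HasDerivAt (fun u : ℝ => Real.sin (ξ * u)) (Real.cos (ξ * u) * (ξ * 1)) u :=
      ((hasDerivAt_id' u).const_mul ξ).sin
    have h := (hcos.neg.mul hA).add ((hsin.const_mul ξ).mul hB)
    have hval : -(-Real.sin (ξ * u) * (ξ * 1)) * a u + -Real.cos (ξ * u) * -(x ⬝ᵥ C *ᵥ ((NormedSpace.exp (-(u • C))) *ᵥ z'')) +
        (ξ * (Real.cos (ξ * u) * (ξ * 1)) * b u + ξ * Real.sin (ξ * u) * -(x ⬝ᵥ C *ᵥ ((NormedSpace.exp (-(u • C))) *ᵥ z'))) = f u := by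
      have e1 : x ⬝ᵥ C *ᵥ ((NormedSpace.exp (-(u • C))) *ᵥ z') = a u := by
        rw [ha, mulVec_exp_neg_smul_comm]
      have e2 : Real.cos (ξ * u) * (x ⬝ᵥ C *ᵥ ((NormedSpace.exp (-(u • C))) *ᵥ z'')) + ξ ^ 2 * Real.cos (ξ * u) * b u = f u := by
        rw [hf, hb, mulVec_exp_neg_smul_comm]
        simp only
        rw [← hSz, Matrix.mulVec_add, Matrix.mulVec_smul, dotProduct_add, dotProduct_smul, smul_eq_mul]
        ring
      rw [e1, ← e2]; ring
    rw [hφ]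
    exact h.congr_deriv hval
  -- continuity, decay, integrability
  have hφc : Continuous φ := continuous_iff_continuousAt.2 fun u => (hderiv u).continuousAt
  have hfc : Continuous f := by
    rw [hf]
    exact (Real.continuous_cos.comp (continuous_const.mul continuous_id)).mul
      (continuous_const.dotProduct (continuous_exp_neg_smul_mulVec C z))
  have hfbound : ∀ u : ℝ, 0 ≤ u → ‖f u‖ ≤ Real.sqrt (x ⬝ᵥ x) * Real.sqrt (z ⬝ᵥ z) * Real.exp (-lo * u) := by
    intro u hu
    rw [hf, Real.norm_eq_abs]
    simp only
    rw [abs_mul]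
    have h1 : |Real.cos (ξ * u)| ≤ 1 := Real.abs_cos_le_one _
    have h2 := abs_form_exp_le hco x z hu
    have h3 : 0 ≤ Real.exp (-(lo * u)) * (Real.sqrt (x ⬝ᵥ x) * Real.sqrt (z ⬝ᵥ z)) := by positivity
    calc |Real.cos (ξ * u)| * |x ⬝ᵥ (NormedSpace.exp (-(u • C))) *ᵥ z|
        ≤ 1 * (Real.exp (-(lo * u)) * (Real.sqrt (x ⬝ᵥ x) * Real.sqrt (z ⬝ᵥ z))) :=
          mul_le_mul h1 h2 (abs_nonneg _) zero_le_one
      _ = Real.sqrt (x ⬝ᵥ x) * Real.sqrt (z ⬝ᵥ z) * Real.exp (-lo * u) := by rw [neg_mul]; ring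
  have hfint : IntegrableOn f (Ioi 0) := by
    refine Integrable.mono' (((exp_neg_integrableOn_Ioi 0 hlo).const_mul (Real.sqrt (x ⬝ᵥ x) * Real.sqrt (z ⬝ᵥ z))))
      hfc.aestronglyMeasurable ?_
    filter_upwards [ae_restrict_mem measurableSet_Ioi] with u hu
    exact hfbound u (le_of_lt hu)
  have hφlim : Filter.Tendsto φ Filter.atTop (nhds 0) := by
    have hK : Filter.Tendsto (fun u : ℝ => (Real.sqrt (x ⬝ᵥ x) * Real.sqrt (z'' ⬝ᵥ z'') +
        |ξ| * (Real.sqrt (x ⬝ᵥ x) * Real.sqrt (z' ⬝ᵥ z'))) * Real.exp (-(lo * u))) Filter.atTop (nhds 0) := by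
      have h0 : Filter.Tendsto (fun u : ℝ => Real.exp (-(lo * u))) Filter.atTop (nhds 0) := by
        have := Real.tendsto_exp_atBot.comp (Filter.tendsto_neg_atTop_atBot.comp (Filter.tendsto_id.const_mul_atTop hlo))
        exact this
      simpa using h0.const_mul (Real.sqrt (x ⬝ᵥ x) * Real.sqrt (z'' ⬝ᵥ z'') + |ξ| * (Real.sqrt (x ⬝ᵥ x) * Real.sqrt (z' ⬝ᵥ z')))
    refine squeeze_zero_norm' ?_ hK
    filter_upwards [Filter.eventually_ge_atTop (0:ℝ)] with u hu
    rw [hφ, Real.norm_eq_abs]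
    simp only
    have h1 := abs_form_exp_le hco x z'' hu
    have h2 := abs_form_exp_le hco x z' hu
    have hc1 : |Real.cos (ξ * u)| ≤ 1 := Real.abs_cos_le_one _
    have hs1 : |Real.sin (ξ * u)| ≤ 1 := Real.abs_sin_le_one _
    calc |-Real.cos (ξ * u) * a u + ξ * Real.sin (ξ * u) * b u|
        ≤ |-Real.cos (ξ * u) * a u| + |ξ * Real.sin (ξ * u) * b u| := abs_add_le _ _
      _ = |Real.cos (ξ * u)| * |a u| + |ξ| * |Real.sin (ξ * u)| * |b u| := by
          rw [abs_mul, abs_mul, abs_mul, abs_neg]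
      _ ≤ 1 * (Real.exp (-(lo * u)) * (Real.sqrt (x ⬝ᵥ x) * Real.sqrt (z'' ⬝ᵥ z''))) +
          |ξ| * 1 * (Real.exp (-(lo * u)) * (Real.sqrt (x ⬝ᵥ x) * Real.sqrt (z' ⬝ᵥ z'))) := by
          exact add_le_add (mul_le_mul hc1 h1 (abs_nonneg _) zero_le_one)
            (mul_le_mul (mul_le_mul_of_nonneg_left hs1 (abs_nonneg ξ)) h2 (abs_nonneg _) (by positivity))
      _ = (Real.sqrt (x ⬝ᵥ x) * Real.sqrt (z'' ⬝ᵥ z'') + |ξ| * (Real.sqrt (x ⬝ᵥ x) * Real.sqrt (z' ⬝ᵥ z'))) *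
          Real.exp (-(lo * u)) := by ring
  -- the fundamental theorem on `(0, ∞)`
  have hFTC := integral_Ioi_of_hasDerivAt_of_tendsto (a := 0) (f := φ) (f' := f) (m := 0)
    hφc.continuousWithinAt (fun u _ => hderiv u) hfint hφlim
  have ha0 : a 0 = x ⬝ᵥ (C * S⁻¹) *ᵥ z := by
    rw [ha]
    simp only [zero_smul, neg_zero, NormedSpace.exp_zero, Matrix.one_mulVec]
    try rw [hz'', hz', Matrix.mulVec_mulVec]
  have hφ0 : φ 0 = -(x ⬝ᵥ (C * S⁻¹) *ᵥ z) := by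
    rw [hφ]
    simp only [mul_zero, Real.cos_zero, Real.sin_zero, zero_mul, add_zero]
    rw [ha0]
    ring
  refine ⟨hfint, ?_⟩
  rw [hFTC, hφ0, zero_sub, neg_neg]

end LaplaceCosine

end Summit.AnomalousDissipation.AnomalousDissipation.Theorems.SolenoidalFractalHomogenisation.LagrangianStep.OddGain
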